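import Literature.Geometry.Kaehler.RiemannSurfaceChevalleyWeilMultiplicities
import Mathlib.LinearAlgebra.Dual.Lemmas
import HarnessLib

/-!
# One-dimensional characters in `𝓗¹(M)`: the multiplicity of `χ` as the dimension of the eigenspace
# `E_χ = ⋂_h Eig(h|𝓗¹(M), χ(h))`, and `mult χ + mult χ̄ = 2(g_S − 1) + 2δ_{χ,1} + #{branch values q : χ(G_q) ≠ 1}`
# (Kopeliovich–Zemel, Proposition 7.1, the statements «for characters»)

Layer `Literature/Geometry/Kaehler`, sequel of `RiemannSurfaceChevalleyWeilMultiplicities` (the Chevalley–Weil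
multiplicities as intertwining numbers `dim Hom_G(V, 𝓗¹(M))`, and Rojas' count
`dim Hom_G(V*, 𝓗¹) + dim Hom_G(V, 𝓗¹) = 2 dim V^G + 2 dim V(γ − 1) + Σ_t (dim V − dim V^{G_t})`). Here the case of
a ONE-DIMENSIONAL representation `(V, ρ)` of `G ≤ Aut M`, i.e. of a linear character `χ = tr ∘ ρ ∈ Ĝ`.
S. Kopeliovich, S. Zemel, Israel J. Math. 234 (2019), as printed (arXiv:1609.02296 p. 30):

> **Proposition 7.1.** The multiplicity in which an element `ρ ∈ Irr_ℂ(G)` appears in `ρ_a` is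
> `d_ρ(g_S − 1) + δ_{ρ,1} + Σ_C r_C Σ_{α=0}^{o(C)−1} N^ρ_{C,α}{α/o(C)}`. In particular, each character `1 ≠ χ ∈ Ĝ`
> appears in `ρ_a` precisely `g_S + t_χ − 1` times, while the multiplicity of `1` in that representation is `g_S`.
> In the complexification of `ρ_r` the representation `ρ` appears with multiplicity
> `d_ρ(2g_S − 2) + 2δ_{ρ,1} + Σ_C r_C(d_ρ − N^ρ_{C,0})`. For characters this number is `2g_S − 2 + Σ_{{C|χ(C)≠1}} r_C`
> if `χ ≠ 1` and just `2g_S` for `χ = 1`.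
> (p. 31, proof) the multiplicity to which `ρ` appears in the action of `G` on `T₀J(X)` via `ρ_a` is the
> multiplicity to which the representation `ρ^*` dual to `ρ` appears in the representation `Ω(1)` […] we recall
> that `χ_{ρ^*}(σ) = χ_ρ(σ⁻¹)`. […] For characters `χ ∈ Ĝ` it is clear that `N^χ_{C,0}` is `1` if `χ(C) = 1` (i.e.,
> if `C ⊆ ker χ`) and `0` otherwise.

Dictionary. `Ω(1) = 𝓗¹(M)` with the tree's action `oneFormRep` restricted to `G`; for a one-dimensional `(V, ρ)`
with character `χ(h) = tr ρ(h)` the multiplicity `dim Hom_G(V, 𝓗¹(M))` is the dimension of the common eigenspace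
`E_χ = {φ ∈ 𝓗¹(M) : hφ = χ(h)φ ∀ h}` (§1), the dual `V*` has character `χ̄ = χ⁻¹`, and `N^χ_{C,0} = dim V^{G_q}` is
`1` or `0` according as the stabilizer `G_q` of a point over the branch value `q` lies in `ker ρ` or not; the sum
`Σ_{{C|χ(C)≠1}} r_C` is the number of branch values `q` with `G_q ⊄ ker ρ`. («`ρ_r ⊗ ℂ ≅ ρ_a ⊕ ρ̄_a`» — the Hodge
decomposition — is not formalised; the statements are about `dim Hom_G(V*, 𝓗¹) + dim Hom_G(V, 𝓗¹)`.)

## What is proved (no definitions, no named facts, no instances)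

* §1 (any group `G`, any `(W, σ)`, `dim V = 1`): `apply_eq_trace_smul` (`ρ(h) = χ(h)·1`), `trace_eq_one_iff_eq_one`,
  **`finrank_intertwiningMap_eq_finrank_iInf_eigenspace`** (`dim Hom_G(V, W) = dim ⋂_h Eig(σ h, χ(h))`, through
  `f ↦ f(v₀)`), `finrank_invariants_eq_ite_of_finrank_eq_one` (`dim V^G = [χ ≡ 1]`),
  `finrank_invariants_comp_subtype_eq_ite_of_finrank_eq_one` (`dim V^K = [χ(K) = 1]` for a subgroup `K`),
  `finrank_dual_eq_one`, `trace_dual_eq_inv` (`χ_{V*}(h) = χ(h)⁻¹`);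
* §2 for `G ≤ Aut M`: **`finrank_iInf_eigenspace_oneFormRep_eq`** (Chevalley–Weil for a linear character as
  `dim E_χ = [χ = 1] + (γ − 1) + Σ_t Σ_α (α/m_t) N_{t,α}`), `…_of_ne_one`, `finrank_iInf_eigenspace_one_oneFormRep_eq`
  (`dim E_1 = γ`), **`finrank_intertwiningMap_dual_add_eq_of_finrank_eq_one`** (PROPOSITION 7.1 «for characters»:
  `dim Hom_G(V*, 𝓗¹) + dim Hom_G(V, 𝓗¹) = 2[χ = 1] + 2(γ − 1) + #{q : χ(G_q) ≠ 1}`), the two printed cases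
  `…_of_ne_one` (`χ ≠ 1`: `2g_S − 2 + #{q : χ(G_q) ≠ 1}`) and `…_of_trivial` (`χ = 1`: `2g_S`), and in eigenspace
  form **`finrank_iInf_eigenspace_inv_add_eq`** (`dim E_{χ⁻¹} + dim E_χ = …`).

## References

* S. Kopeliovich, S. Zemel, *On spaces associated with invariant divisors on Galois covers of Riemann surfaces and
  their applications*, Israel J. Math. 234 (2019), Proposition 7.1 and its proof (arXiv:1609.02296 pp. 30–31).
  [KopeliovichZemel2019]
* A. M. Rojas, *Group actions on Jacobian varieties*, Rev. Mat. Iberoam. 23 (2007), Theorem 5.10. [Rojas2007]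
* J.-P. Serre, *Linear Representations of Finite Groups*, GTM 42 (1977), §2.3. [SerreLinearRepresentations1977]
-/

noncomputable section

open scoped Manifold ContDiff Topology
open Set Filter Function Complex MulAction Module

namespace Literature.Geometry.Kaehler

namespace RiemannSurface

/-! ### §1 One-dimensional representations: `Hom_G(V, W) ≅ E_χ(W)` -/

section OneDim

variable {G : Type*} [Group G] {V : Type*} [AddCommGroup V] [Module ℂ V] (ρ : Representation ℂ G V)
  {W : Type*} [AddCommGroup W] [Module ℂ W] (σ : Representation ℂ G W)

/-- On a one-dimensional representation every `ρ(h)` is the scalar `χ(h) = tr ρ(h)`.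
[cite: KopeliovichZemel2019, §1 («`χ ∈ Ĝ`»)] -/
theorem apply_eq_trace_smul (hV : finrank ℂ V = 1) (h : G) (v : V) :
    ρ h v = LinearMap.trace ℂ V (ρ h) • v := by
  haveI : FiniteDimensional ℂ V := .of_finrank_eq_succ hV
  obtain ⟨w, hw0, hw⟩ := finrank_eq_one_iff'.1 hV
  obtain ⟨c, hc⟩ : ∃ c : ℂ, ρ h = c • LinearMap.id := by
    obtain ⟨c, hcw⟩ := hw (ρ h w)
    refine ⟨c, LinearMap.ext fun v ↦ ?_⟩
    obtain ⟨a, ha⟩ := hw v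
    rw [← ha, map_smul, ← hcw, LinearMap.smul_apply, LinearMap.id_apply, smul_comm]
  rw [hc, map_smul, LinearMap.trace_id, hV, Nat.cast_one, smul_eq_mul, mul_one, LinearMap.smul_apply,
    LinearMap.id_apply]

/-- The character of a one-dimensional representation takes the value `1` at `h` iff `ρ(h) = 1`.
[cite: KopeliovichZemel2019, Proposition 7.1 (proof)] -/
theorem trace_eq_one_iff_eq_one (hV : finrank ℂ V = 1) (h : G) : LinearMap.trace ℂ V (ρ h) = 1 ↔ ρ h = 1 := by
  haveI : FiniteDimensional ℂ V := .of_finrank_eq_succ hV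
  constructor
  · intro h1
    refine LinearMap.ext fun u ↦ ?_
    rw [apply_eq_trace_smul ρ hV h u, h1, one_smul, Module.End.one_apply]
  · intro h1
    rw [h1, LinearMap.trace_one, hV, Nat.cast_one]

/-- **For `dim V = 1`, `dim Hom_G(V, W) = dim E_χ(W)`, `E_χ(W) = ⋂_h Eig(σ(h), χ(h))` the common eigenspace of the
character `χ = tr ∘ ρ`** (evaluation `f ↦ f(v₀)` at a basis vector is a linear isomorphism `Hom_G(V, W) ≅ E_χ(W)`: an
equivariant `f` has `σ(h)f(v₀) = f(ρ(h)v₀) = χ(h)f(v₀)`, and conversely `w ∈ E_χ` gives `c·v₀ ↦ c·w`). This is the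
multiplicity of the character `χ` («the multiplicity of `ρ` inside any representation of `G` on some vector space
`V` is `(1/n) Σ_τ χ_V(τ)χ_ρ(τ⁻¹)`», for `d_ρ = 1`). [cite: KopeliovichZemel2019, Theorem 6.6 (proof), Proposition 7.1]
[cite: SerreLinearRepresentations1977, §2.3] -/
theorem finrank_intertwiningMap_eq_finrank_iInf_eigenspace (hV : finrank ℂ V = 1) :
    finrank ℂ (Representation.IntertwiningMap ρ σ) =
      finrank ℂ ↥(⨅ h : G, Module.End.eigenspace (σ h) (LinearMap.trace ℂ V (ρ h))) := by
  haveI : FiniteDimensional ℂ V := .of_finrank_eq_succ hV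
  set E : Submodule ℂ W := ⨅ h : G, Module.End.eigenspace (σ h) (LinearMap.trace ℂ V (ρ h)) with hE
  have hmemE : ∀ x : W, x ∈ E ↔ ∀ h : G, σ h x = LinearMap.trace ℂ V (ρ h) • x := fun x ↦ by
    simp only [hE, Submodule.mem_iInf, Module.End.mem_eigenspace_iff]
  -- a basis vector `w` and its coordinate functional: `v = coord v • w`
  let b := Module.finBasisOfFinrankEq ℂ V hV
  set w : V := b 0 with hwdef
  have hw0 : w ≠ 0 := b.ne_zero 0
  set coord : V →ₗ[ℂ] ℂ := b.coord 0 with hcoorddef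
  have hcoord : ∀ v, coord v • w = v := fun v ↦ by
    conv_rhs => rw [← b.sum_repr v]
    rw [Fin.sum_univ_one]
    rfl
  have hcw : coord w = 1 := by
    have h1 : coord w = b.repr (b 0) 0 := rfl
    rw [h1, b.repr_self, Finsupp.single_eq_same]
  -- evaluation at `w`
  have hval : ∀ f : Representation.IntertwiningMap ρ σ, f w ∈ E := fun f ↦ by
    rw [hmemE]
    intro h
    rw [← f.isIntertwining, apply_eq_trace_smul ρ hV h w, map_smul]
  let Φ : Representation.IntertwiningMap ρ σ →ₗ[ℂ] ↥E :=
    { toFun := fun f ↦ ⟨f w, hval f⟩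
      map_add' := fun f g ↦ rfl
      map_smul' := fun c f ↦ rfl }
  refine LinearEquiv.finrank_eq (LinearEquiv.ofBijective Φ ⟨?_, ?_⟩)
  · intro f g hfg
    have hfg' : f w = g w := congrArg Subtype.val hfg
    apply Representation.IntertwiningMap.ext
    refine LinearMap.ext fun v ↦ ?_
    rw [Representation.IntertwiningMap.toLinearMap_apply, Representation.IntertwiningMap.toLinearMap_apply,
      ← hcoord v, map_smul, map_smul, hfg']
  · rintro ⟨x, hx⟩
    have hx' := (hmemE x).1 hx
    refine ⟨LinearMap.intertwiningMap_of_isIntertwiningMap (ρ := ρ) (σ := σ) (coord.smulRight x) ?_, ?_⟩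
    · intro h v
      rw [LinearMap.smulRight_apply, LinearMap.smulRight_apply, apply_eq_trace_smul ρ hV h v, map_smul,
        smul_eq_mul, mul_smul, map_smul, hx' h, smul_comm]
    · apply Subtype.ext
      change (coord.smulRight x) w = x
      rw [LinearMap.smulRight_apply, hcw, one_smul]

/-- **For `dim V = 1`: `dim V^G = 1` if `χ ≡ 1` and `0` otherwise** (`δ_{χ,1}`).
[cite: KopeliovichZemel2019, Proposition 7.1] -/
theorem finrank_invariants_eq_ite_of_finrank_eq_one (hV : finrank ℂ V = 1)
    [Decidable (∀ h : G, LinearMap.trace ℂ V (ρ h) = 1)] :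
    finrank ℂ ↥ρ.invariants = if ∀ h : G, LinearMap.trace ℂ V (ρ h) = 1 then 1 else 0 := by
  haveI : FiniteDimensional ℂ V := .of_finrank_eq_succ hV
  split_ifs with hK
  · have htop : ρ.invariants = ⊤ := by
      refine eq_top_iff.2 fun v _ ↦ ?_
      rw [Representation.mem_invariants]
      intro k
      rw [(trace_eq_one_iff_eq_one ρ hV k).1 (hK k), Module.End.one_apply]
    rw [htop, finrank_top, hV]
  · obtain ⟨k, hk⟩ : ∃ k, LinearMap.trace ℂ V (ρ k) ≠ 1 := by
      by_contra hcon
      push Not at hcon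
      exact hK hcon
    have hbot : ρ.invariants = ⊥ := by
      refine eq_bot_iff.2 fun v hv ↦ ?_
      rw [Submodule.mem_bot]
      rw [Representation.mem_invariants] at hv
      have hkv := hv k
      rw [apply_eq_trace_smul ρ hV k v] at hkv
      have : (LinearMap.trace ℂ V (ρ k) - 1) • v = 0 := by rw [sub_smul, one_smul, hkv, sub_self]
      exact (smul_eq_zero.1 this).resolve_left (sub_ne_zero.2 hk)
    rw [hbot, finrank_bot]

/-- **For `dim V = 1` and a subgroup `K`: `dim V^K = 1` if `χ(K) = 1` and `0` otherwise** («`N^χ_{C,0}` is `1` if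
`χ(C) = 1` (i.e., if `C ⊆ ker χ`) and `0` otherwise»). [cite: KopeliovichZemel2019, Proposition 7.1 (proof)] -/
theorem finrank_invariants_comp_subtype_eq_ite_of_finrank_eq_one (hV : finrank ℂ V = 1) (K : Subgroup G)
    [Decidable (∀ k ∈ K, LinearMap.trace ℂ V (ρ k) = 1)] :
    finrank ℂ ↥(Representation.invariants (ρ.comp K.subtype)) = if ∀ k ∈ K, LinearMap.trace ℂ V (ρ k) = 1 then 1 else 0 := by
  classical
  rw [finrank_invariants_eq_ite_of_finrank_eq_one (ρ.comp K.subtype) hV]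
  have hiff : (∀ h : ↥K, LinearMap.trace ℂ V (ρ.comp K.subtype h) = 1) ↔ ∀ k ∈ K, LinearMap.trace ℂ V (ρ k) = 1 :=
    ⟨fun H k hk ↦ H ⟨k, hk⟩, fun H h ↦ H h.1 h.2⟩
  simp only [hiff]

/-- The dual of a one-dimensional representation is one-dimensional. [cite: KopeliovichZemel2019, Proposition 7.1 (proof)] -/
theorem finrank_dual_eq_one (hV : finrank ℂ V = 1) : finrank ℂ (Module.Dual ℂ V) = 1 := by
  haveI : FiniteDimensional ℂ V := .of_finrank_eq_succ hV
  rw [Subspace.dual_finrank_eq, hV]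

/-- **`χ_{V*}(h) = χ(h)⁻¹`** for a one-dimensional `V` («`χ_{ρ^*}(σ) = χ_ρ(σ⁻¹)`»).
[cite: KopeliovichZemel2019, Proposition 7.1 (proof)] -/
theorem trace_dual_eq_inv (hV : finrank ℂ V = 1) (h : G) :
    LinearMap.trace ℂ (Module.Dual ℂ V) (ρ.dual h) = (LinearMap.trace ℂ V (ρ h))⁻¹ := by
  haveI : FiniteDimensional ℂ V := .of_finrank_eq_succ hV
  have h1 : LinearMap.trace ℂ (Module.Dual ℂ V) (ρ.dual h) = LinearMap.trace ℂ V (ρ h⁻¹) :=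
    Representation.char_dual ρ h
  rw [h1]
  -- `χ(h)χ(h⁻¹) = χ(1) = 1`
  have hmul : LinearMap.trace ℂ V (ρ h) * LinearMap.trace ℂ V (ρ h⁻¹) = 1 := by
    obtain ⟨w, hw0, -⟩ := finrank_eq_one_iff'.1 hV
    have h2 : ρ h⁻¹ (ρ h w) = w := by
      rw [← Module.End.mul_apply, ← map_mul, inv_mul_cancel, map_one, Module.End.one_apply]
    rw [apply_eq_trace_smul ρ hV h w, map_smul, apply_eq_trace_smul ρ hV h⁻¹ w, smul_smul] at h2
    have : (LinearMap.trace ℂ V (ρ h) * LinearMap.trace ℂ V (ρ h⁻¹) - 1) • w = 0 := by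
      rw [sub_smul, one_smul, h2, sub_self]
    exact sub_eq_zero.1 ((smul_eq_zero.1 this).resolve_right hw0)
  exact eq_inv_of_mul_eq_one_right hmul

end OneDim

/-! ### §2 Linear characters in `𝓗¹(M)` -/

section OneForms

variable {M : Type*} [TopologicalSpace M] [ChartedSpace ℂ M] [IsManifold 𝓘(ℂ, ℂ) ω M]
  [CompactSpace M] [T2Space M] [PreconnectedSpace M] [Nonempty M] [Finite (autGroup M)]
  (G : Subgroup (autGroup M)) {V : Type*} [AddCommGroup V] [Module ℂ V] (ρ : Representation ℂ ↥G V)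

open OrbitSurface

open Classical in
/-- **Chevalley–Weil for a linear character `χ`: `dim E_χ = dim V^G + (γ − 1) + Σ_t Σ_α (α/m_t) N_{t,α}`**, where
`E_χ = {φ ∈ 𝓗¹(M) : hφ = χ(h)φ}` is the `χ`-eigenspace of `G` on `𝓗¹(M)`, `dim V^G = [χ = 1]` («each character
`1 ≠ χ ∈ Ĝ` appears in `ρ_a` precisely `g_S + t_χ − 1` times, while the multiplicity of `1` … is `g_S`»; the
branch-value sum in closed form `Σ_q u_q/r_q` is the tree's `chevalleyWeil_character_multiplicity_eq_sum_branchValues`).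
[cite: KopeliovichZemel2019, Proposition 7.1] -/
theorem finrank_iInf_eigenspace_oneFormRep_eq [Fintype ↥G] (hV : finrank ℂ V = 1) :
    (finrank ℂ ↥(⨅ h : ↥G, Module.End.eigenspace (oneFormRep M (h : autGroup M)) (LinearMap.trace ℂ V (ρ h))) : ℂ) =
      (finrank ℂ ↥ρ.invariants : ℂ) + ((arithGenus (OrbitSurface G M) : ℂ) - 1) +
      ∑ q ∈ (branchDiv (mk G : M → OrbitSurface G M)).support,
        ∑ α ∈ Finset.range (stabOrder q),
          (α : ℂ) / (stabOrder q : ℂ) * finrank ℂ ↥(⨅ h : ↥(stabilizer G q.out),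
            Module.End.eigenspace (ρ (h : ↥G)) (stabDeriv q.out (h : ↥G) ^ α)) := by
  haveI : FiniteDimensional ℂ V := .of_finrank_eq_succ hV
  have h := finrank_intertwiningMap_oneFormRep_eq_sum_branchValues G ρ
  rw [finrank_intertwiningMap_eq_finrank_iInf_eigenspace ρ ((oneFormRep M).comp G.subtype) hV, hV, Nat.cast_one,
    one_mul] at h
  exact h

open Classical in
/-- **`dim E_χ = (γ − 1) + Σ_t Σ_α (α/m_t) N_{t,α}` for a non-trivial linear character** («`g_S + t_χ − 1`»).
[cite: KopeliovichZemel2019, Proposition 7.1] -/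
theorem finrank_iInf_eigenspace_oneFormRep_eq_of_ne_one [Fintype ↥G] (hV : finrank ℂ V = 1)
    (hχ : ∃ h : ↥G, LinearMap.trace ℂ V (ρ h) ≠ 1) :
    (finrank ℂ ↥(⨅ h : ↥G, Module.End.eigenspace (oneFormRep M (h : autGroup M)) (LinearMap.trace ℂ V (ρ h))) : ℂ) =
      ((arithGenus (OrbitSurface G M) : ℂ) - 1) +
      ∑ q ∈ (branchDiv (mk G : M → OrbitSurface G M)).support,
        ∑ α ∈ Finset.range (stabOrder q),
          (α : ℂ) / (stabOrder q : ℂ) * finrank ℂ ↥(⨅ h : ↥(stabilizer G q.out),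
            Module.End.eigenspace (ρ (h : ↥G)) (stabDeriv q.out (h : ↥G) ^ α)) := by
  have hnot : ¬ ∀ h : ↥G, LinearMap.trace ℂ V (ρ h) = 1 := by push Not; exact hχ
  rw [finrank_iInf_eigenspace_oneFormRep_eq G ρ hV, finrank_invariants_eq_ite_of_finrank_eq_one ρ hV, if_neg hnot,
    Nat.cast_zero, zero_add]

/-- **The trivial character: `dim 𝓗¹(M)^G = γ`** in eigenspace form (`E_1 = ⋂_h Eig(h, 1)`; «the multiplicity of `1`
in that representation is `g_S`»). [cite: KopeliovichZemel2019, Proposition 7.1] -/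
theorem finrank_iInf_eigenspace_one_oneFormRep_eq [Fintype ↥G] :
    finrank ℂ ↥(⨅ h : ↥G, Module.End.eigenspace (oneFormRep M (h : autGroup M)) 1) = arithGenus (OrbitSurface G M) := by
  classical
  rw [← finrank_invariants_oneFormRep_comp_subtype G]
  have hsub : (⨅ h : ↥G, Module.End.eigenspace (oneFormRep M (h : autGroup M)) 1) =
      Representation.invariants ((oneFormRep M).comp G.subtype) := by
    ext φ
    simp only [Submodule.mem_iInf, Module.End.mem_eigenspace_iff, one_smul, Representation.mem_invariants]
    rfl
  rw [hsub]

open Classical in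
/-- **PROPOSITION 7.1 «for characters», general form**: for a one-dimensional `(V, ρ)`,
`dim Hom_G(V*, 𝓗¹(M)) + dim Hom_G(V, 𝓗¹(M)) = 2 dim V^G + 2(γ − 1) + #{branch values q : χ(G_q) ≠ 1}`
(`d_ρ = 1`, `N^χ_{C,0} = [χ(C) = 1]`). [cite: KopeliovichZemel2019, Proposition 7.1] [cite: Rojas2007, Theorem 5.10] -/
theorem finrank_intertwiningMap_dual_add_eq_of_finrank_eq_one [Fintype ↥G] (hV : finrank ℂ V = 1) :
    (finrank ℂ (Representation.IntertwiningMap ρ.dual ((oneFormRep M).comp G.subtype)) : ℂ) +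
        finrank ℂ (Representation.IntertwiningMap ρ ((oneFormRep M).comp G.subtype)) =
      2 * (finrank ℂ ↥ρ.invariants : ℂ) + 2 * ((arithGenus (OrbitSurface G M) : ℂ) - 1) +
      (((branchDiv (mk G : M → OrbitSurface G M)).support.filter fun q : OrbitSurface G M ↦
        ∃ h ∈ stabilizer (↥G) q.out, LinearMap.trace ℂ V (ρ h) ≠ 1).card : ℂ) := by
  haveI : FiniteDimensional ℂ V := .of_finrank_eq_succ hV
  rw [finrank_intertwiningMap_dual_add_finrank_intertwiningMap_eq G ρ, hV, Nat.cast_one, mul_one]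
  congr 1
  rw [Finset.card_filter, Nat.cast_sum]
  refine Finset.sum_congr rfl fun q _ ↦ ?_
  rw [finrank_invariants_comp_subtype_eq_ite_of_finrank_eq_one ρ hV (stabilizer (↥G) q.out)]
  by_cases hq : ∃ h ∈ stabilizer (↥G) q.out, LinearMap.trace ℂ V (ρ h) ≠ 1
  · have hq' : ¬ ∀ k ∈ stabilizer (↥G) q.out, LinearMap.trace ℂ V (ρ k) = 1 := by push Not; exact hq
    rw [if_neg hq', if_pos hq]; simp
  · have hq' : ∀ k ∈ stabilizer (↥G) q.out, LinearMap.trace ℂ V (ρ k) = 1 := by push Not at hq; exact hq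
    rw [if_pos hq', if_neg hq]; simp

open Classical in
/-- **«For characters this number is `2g_S − 2 + Σ_{{C|χ(C)≠1}} r_C` if `χ ≠ 1`»**: for a non-trivial linear
character, `dim Hom_G(V*, 𝓗¹(M)) + dim Hom_G(V, 𝓗¹(M)) = 2g_S − 2 + #{branch values q : χ(G_q) ≠ 1}`.
[cite: KopeliovichZemel2019, Proposition 7.1] -/
theorem finrank_intertwiningMap_dual_add_eq_of_ne_one [Fintype ↥G] (hV : finrank ℂ V = 1)
    (hχ : ∃ h : ↥G, LinearMap.trace ℂ V (ρ h) ≠ 1) :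
    (finrank ℂ (Representation.IntertwiningMap ρ.dual ((oneFormRep M).comp G.subtype)) : ℂ) +
        finrank ℂ (Representation.IntertwiningMap ρ ((oneFormRep M).comp G.subtype)) =
      2 * (arithGenus (OrbitSurface G M) : ℂ) - 2 +
      (((branchDiv (mk G : M → OrbitSurface G M)).support.filter fun q : OrbitSurface G M ↦
        ∃ h ∈ stabilizer (↥G) q.out, LinearMap.trace ℂ V (ρ h) ≠ 1).card : ℂ) := by
  have hnot : ¬ ∀ h : ↥G, LinearMap.trace ℂ V (ρ h) = 1 := by push Not; exact hχ
  rw [finrank_intertwiningMap_dual_add_eq_of_finrank_eq_one G ρ hV, finrank_invariants_eq_ite_of_finrank_eq_one ρ hV,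
    if_neg hnot, Nat.cast_zero, mul_zero, zero_add, mul_sub, mul_one]

open Classical in
/-- **«… and just `2g_S` for `χ = 1`»**: for the trivial character, `dim Hom_G(V*, 𝓗¹(M)) + dim Hom_G(V, 𝓗¹(M)) = 2γ`.
[cite: KopeliovichZemel2019, Proposition 7.1] -/
theorem finrank_intertwiningMap_dual_add_eq_of_trivial [Fintype ↥G] (hV : finrank ℂ V = 1)
    (hχ : ∀ h : ↥G, LinearMap.trace ℂ V (ρ h) = 1) :
    (finrank ℂ (Representation.IntertwiningMap ρ.dual ((oneFormRep M).comp G.subtype)) : ℂ) +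
        finrank ℂ (Representation.IntertwiningMap ρ ((oneFormRep M).comp G.subtype)) =
      2 * (arithGenus (OrbitSurface G M) : ℂ) := by
  rw [finrank_intertwiningMap_dual_add_eq_of_finrank_eq_one G ρ hV, finrank_invariants_eq_ite_of_finrank_eq_one ρ hV,
    if_pos hχ]
  have hempty : ((branchDiv (mk G : M → OrbitSurface G M)).support.filter fun q : OrbitSurface G M ↦
      ∃ h ∈ stabilizer (↥G) q.out, LinearMap.trace ℂ V (ρ h) ≠ 1) = ∅ := by
    refine Finset.filter_false_of_mem fun q _ ↦ ?_
    push Not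
    exact fun h _ ↦ hχ h
  rw [hempty, Finset.card_empty, Nat.cast_one, Nat.cast_zero]
  ring

open Classical in
/-- **Proposition 7.1 for characters, eigenspace form: `dim E_{χ⁻¹} + dim E_χ = 2[χ = 1] + 2(γ − 1) + #{q : χ(G_q) ≠ 1}`**,
`E_χ`, `E_{χ⁻¹} ⊆ 𝓗¹(M)` the common eigenspaces of `χ` and of `χ̄ = χ⁻¹ = χ_{V*}` (the multiplicities of `χ` in
`ρ_a` and in `ρ̄_a`). [cite: KopeliovichZemel2019, Proposition 7.1] [cite: Rojas2007, Theorem 5.10] -/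
theorem finrank_iInf_eigenspace_inv_add_eq [Fintype ↥G] (hV : finrank ℂ V = 1) :
    (finrank ℂ ↥(⨅ h : ↥G, Module.End.eigenspace (oneFormRep M (h : autGroup M)) (LinearMap.trace ℂ V (ρ h))⁻¹) : ℂ) +
        finrank ℂ ↥(⨅ h : ↥G, Module.End.eigenspace (oneFormRep M (h : autGroup M)) (LinearMap.trace ℂ V (ρ h))) =
      2 * (finrank ℂ ↥ρ.invariants : ℂ) + 2 * ((arithGenus (OrbitSurface G M) : ℂ) - 1) +
      (((branchDiv (mk G : M → OrbitSurface G M)).support.filter fun q : OrbitSurface G M ↦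
        ∃ h ∈ stabilizer (↥G) q.out, LinearMap.trace ℂ V (ρ h) ≠ 1).card : ℂ) := by
  haveI : FiniteDimensional ℂ V := .of_finrank_eq_succ hV
  have h := finrank_intertwiningMap_dual_add_eq_of_finrank_eq_one G ρ hV
  rw [finrank_intertwiningMap_eq_finrank_iInf_eigenspace ρ ((oneFormRep M).comp G.subtype) hV,
    finrank_intertwiningMap_eq_finrank_iInf_eigenspace ρ.dual ((oneFormRep M).comp G.subtype)
      (finrank_dual_eq_one hV)] at h
  have hI : (⨅ g : ↥G, Module.End.eigenspace (((oneFormRep M).comp G.subtype) g)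
      (LinearMap.trace ℂ (Module.Dual ℂ V) (ρ.dual g))) =
      ⨅ g : ↥G, Module.End.eigenspace (oneFormRep M (g : autGroup M)) (LinearMap.trace ℂ V (ρ g))⁻¹ :=
    iInf_congr fun g ↦ by rw [trace_dual_eq_inv ρ hV g]; rfl
  rw [hI] at h
  exact h

end OneForms

end RiemannSurface

end Literature.Geometry.Kaehler
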